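import Summits.CriticalPhenomena.PercolationContinuityZ3.Theorems.PercNearOneGluingNoHeavyLowerTailUniformLevelCounting
import Summits.CriticalPhenomena.PercolationContinuityZ3.Theorems.PercNearOneGluingHalfWeightReduction
import Summits.CriticalPhenomena.PercolationContinuityZ3.Theorems.PercNearOneGluingNoHeavyLowerTailResidualOfNearOneGluing
import Literature.Probability.Percolation.PercolationProofs

/-!
# Crux `PercNearOneGluing.NoHeavyLowerTail` (stmt-CriticalPhenomena-4575), line `bhk-superadditivity-thinning`:
# the GRADED additive gluing statement implies `NearOneGluing` and the line's residual

Lead c6, 2026-08-17; lands with `--supports stmt-CriticalPhenomena-4575`.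

`GAG` (graded additive gluing) is the purely combinatorial statement: on every finite simple graph
`G` on `Fin n`, for every relay set `A ≠ ∅`, observer `o` and target `b`, ONE relay `a ∈ A` satisfies,
for every level `k`,
`#{S ⊆ E(G) : |S| = k, S ∈ {o ↔ A} ∩ {o ↮ b}} ≤ #{S ⊆ E(G) : |S| = k, S ∉ {a ↔ b}}`
(level counts over the edge finset `Eset (edgeList G)` of the certified checkers).  The lead's exhaustive
enumeration found no failure on any graph with at most `7` vertices; the kernel-checked windows are
`additiveGluing_uniform_le_five/six` (`Theorems/PercNearOneGluingNoHeavyLowerTailUniformCertLeFive/Six.lean`).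

This file is the typed reduction, pure logic on landed theorems:

* `additiveGluing_uniform_of_gradedAG` — `GAG` gives additive gluing at EVERY uniform density `p` on
  simple graphs: `P_p(o ↔ A) − t ≤ P_p(o ↔ b)` whenever `t ≥ 0` and `P_p(a ↔ b) ≥ 1 − t` on `A`
  (`bondPercolation_eq_prodBernoulli_uniformOn`, level-wise dominance
  `uniformOn_real_mono_of_levelCount_le` with `D₁ = {o ↔ A} ∩ {o ↮ b}`, `D₂ = {a ↮ b}`, and
  `P(o ↔ A) ≤ P({o ↔ A} ∩ {o ↮ b}) + P(o ↔ b)`);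
* `nearOneGluing_of_gradedAG` (registered stub) — at density `1/2` with `t = δ = ε / 2` this is the
  hypothesis of `HalfWeightReduction` (Kozma–Nitzan §5.6 (1), `halfWeightReduction_proof`), whence
  `NearOneGluing`;
* `manyFingersLargePocket_of_gradedAG` (registered stub) — composed with
  `manyFingersLargePocket_of_nearOneGluing`, the line's residual.

Both registered theorems are CONDITIONAL on `GAG` (a hypothesis).  Nothing here asserts or refutes the crux.
-/

namespace Summit.CriticalPhenomena.PercolationContinuityZ3.Theorems

open MeasureTheory
open Literature.Probability.LatticeModels Literature.Probability.Percolation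
open Summit.CriticalPhenomena.PercolationContinuityZ3.Theorems.AdditiveGluing.Negative.Cert
open Summit.CriticalPhenomena.PercolationContinuityZ3.Theses.PercNearOneGluing

open Classical in
/-- **Additive gluing at every uniform density from graded additive gluing.** If `GAG` holds then for
every simple graph `G` on `Fin n`, every `p ∈ [0, 1]`, `A`, `o`, `b` and `t ≥ 0` with
`P_p(a ↔ b) ≥ 1 − t` on `A`: `P_p(o ↔ A) − t ≤ P_p(o ↔ b)`.  (For `A = ∅` the left side is `−t ≤ 0`;
otherwise the relay `a` of `GAG` gives `P_p({o ↔ A} ∩ {o ↮ b}) ≤ P_p(a ↮ b) = 1 − P_p(a ↔ b) ≤ t` by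
level-wise dominance, and `P(o ↔ A) ≤ P({o ↔ A} ∩ {o ↮ b}) + P(o ↔ b)`.) -/
theorem additiveGluing_uniform_of_gradedAG (hG : (∀ (n : ℕ) (G : SimpleGraph (Fin n)) (A : Finset (Fin n)) (o b : Fin n), A.Nonempty → ∃ a ∈ A, ∀ k : ℕ, ((Summit.CriticalPhenomena.PercolationContinuityZ3.Theorems.AdditiveGluing.Negative.Cert.Eset (Summit.CriticalPhenomena.PercolationContinuityZ3.Theorems.AdditiveGluing.Negative.Cert.edgeList G)).powerset.filter fun S : Finset (Sym2 (Fin n)) => S.card = k ∧ (↑S : Set (Sym2 (Fin n))) ∈ ((⋃ x ∈ A, Literature.Probability.Percolation.openConn o x) ∩ (Literature.Probability.Percolation.openConn o b)ᶜ : Set (Set (Sym2 (Fin n))))).card ≤ ((Summit.CriticalPhenomena.PercolationContinuityZ3.Theorems.AdditiveGluing.Negative.Cert.Eset (Summit.CriticalPhenomena.PercolationContinuityZ3.Theorems.AdditiveGluing.Negative.Cert.edgeList G)).powerset.filter fun S : Finset (Sym2 (Fin n)) => S.card = k ∧ (↑S : Set (Sym2 (Fin n))) ∈ ((Literature.Probability.Percolation.openConn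 a b)ᶜ : Set (Set (Sym2 (Fin n))))).card)) {n : ℕ} (G : SimpleGraph (Fin n)) (p : unitInterval) (A : Finset (Fin n)) (o b : Fin n) (t : ℝ)
    (ht : 0 ≤ t) (hrel : ∀ a ∈ A, 1 - t ≤ (bondPercolation G p).real (openConn a b)) :
    (bondPercolation G p).real (⋃ a ∈ A, openConn o a) - t ≤ (bondPercolation G p).real (openConn o b) := by
  by_cases hA : A = ∅
  · subst hA
    simp only [Finset.notMem_empty, Set.iUnion_of_empty, Set.iUnion_empty, measureReal_empty]
    linarith [measureReal_nonneg (μ := bondPercolation G p) (s := openConn o b)]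
  obtain ⟨a, haA, hle⟩ := hG n G A o b (Finset.nonempty_iff_ne_empty.2 hA)
  have hD : (bondPercolation G p).real ((⋃ x ∈ A, openConn o x) ∩ (openConn o b)ᶜ) ≤
      (bondPercolation G p).real (openConn a b)ᶜ := by
    rw [bondPercolation_eq_prodBernoulli_uniformOn G p]
    -- the `Decidable` instances of the two filters differ syntactically; `convert` closes them
    exact uniformOn_real_mono_of_levelCount_le (Eset (edgeList G)) p _ _ fun k => by convert hle k using 3
  rw [probReal_compl_eq_one_sub (measurableSet_openConn_holds a b)] at hD
  have hsplit : (bondPercolation G p).real (⋃ a ∈ A, openConn o a) ≤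
      (bondPercolation G p).real ((⋃ x ∈ A, openConn o x) ∩ (openConn o b)ᶜ) +
        (bondPercolation G p).real (openConn o b) :=
    (measureReal_mono (fun ω hω => by
      by_cases hb : ω ∈ openConn o b
      · exact Or.inr hb
      · exact Or.inl ⟨hω, hb⟩)).trans (measureReal_union_le _ _)
  linarith [hrel a haA]

open Classical in
/-- **Graded additive gluing implies `NearOneGluing`** (registered stub, line
`bhk-superadditivity-thinning`): at density `1/2` on simple graphs, `additiveGluing_uniform_of_gradedAG`
with `t = δ = ε / 2` turns `P(o ↔ A) > 1 − ε/2` and `P(a ↔ b) > 1 − ε/2` on `A` into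
`P(o ↔ b) > 1 − ε`; this is the hypothesis of `HalfWeightReduction` (`halfWeightReduction_proof`). -/
theorem nearOneGluing_of_gradedAG : (∀ (n : ℕ) (G : SimpleGraph (Fin n)) (A : Finset (Fin n)) (o b : Fin n), A.Nonempty → ∃ a ∈ A, ∀ k : ℕ, ((Summit.CriticalPhenomena.PercolationContinuityZ3.Theorems.AdditiveGluing.Negative.Cert.Eset (Summit.CriticalPhenomena.PercolationContinuityZ3.Theorems.AdditiveGluing.Negative.Cert.edgeList G)).powerset.filter fun S : Finset (Sym2 (Fin n)) => S.card = k ∧ (↑S : Set (Sym2 (Fin n))) ∈ ((⋃ x ∈ A, Literature.Probability.Percolation.openConn o x) ∩ (Literature.Probability.Percolation.openConn o b)ᶜ : Set (Set (Sym2 (Fin n))))).card ≤ ((Summit.CriticalPhenomena.PercolationContinuityZ3.Theorems.AdditiveGluing.Negative.Cert.Eset (Summit.CriticalPhenomena.PercolationContinuityZ3.Theorems.AdditiveGluing.Negative.Cert.edgeList G)).powerset.filter fun S : Finset (Sym2 (Fin n)) => S.card = k ∧ (↑S : Set (Sym2 (Fin n))) ∈ ((Literature.Probability.Percolation.openConn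 a b)ᶜ : Set (Set (Sym2 (Fin n))))).card) → Summit.CriticalPhenomena.PercolationContinuityZ3.Theses.PercNearOneGluing.NearOneGluing := by
  intro hG
  refine halfWeightReduction_proof ?_
  intro ε hε
  refine ⟨ε / 2, half_pos hε, ?_⟩
  intro n G A o b hoA hAb
  have h := additiveGluing_uniform_of_gradedAG hG G half A o b (ε / 2) (half_pos hε).le
    (fun a ha => (hAb a ha).le)
  linarith

open Classical in
/-- **Graded additive gluing implies the line's residual** (registered stub, line
`bhk-superadditivity-thinning`): `manyFingersLargePocket_of_nearOneGluing` composed with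
`nearOneGluing_of_gradedAG`. -/
theorem manyFingersLargePocket_of_gradedAG : (∀ (n : ℕ) (G : SimpleGraph (Fin n)) (A : Finset (Fin n)) (o b : Fin n), A.Nonempty → ∃ a ∈ A, ∀ k : ℕ, ((Summit.CriticalPhenomena.PercolationContinuityZ3.Theorems.AdditiveGluing.Negative.Cert.Eset (Summit.CriticalPhenomena.PercolationContinuityZ3.Theorems.AdditiveGluing.Negative.Cert.edgeList G)).powerset.filter fun S : Finset (Sym2 (Fin n)) => S.card = k ∧ (↑S : Set (Sym2 (Fin n))) ∈ ((⋃ x ∈ A, Literature.Probability.Percolation.openConn o x) ∩ (Literature.Probability.Percolation.openConn o b)ᶜ : Set (Set (Sym2 (Fin n))))).card ≤ ((Summit.CriticalPhenomena.PercolationContinuityZ3.Theorems.AdditiveGluing.Negative.Cert.Eset (Summit.CriticalPhenomena.PercolationContinuityZ3.Theorems.AdditiveGluing.Negative.Cert.edgeList G)).powerset.filter fun S : Finset (Sym2 (Fin n)) => S.card = k ∧ (↑S : Set (Sym2 (Fin n))) ∈ ((Literature.Probability.Percolation.openConn a b)ᶜ : Set (Set (Sym2 (Fin n))))).card) → ∀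 ε : ℝ, 0 < ε → ∃ (δ : ℝ) (d₀ s₀ : ℕ), 0 < δ ∧ ∀ (n : ℕ) (w : Sym2 (Fin n) → unitInterval) (A : Finset (Fin n)) (o a₀ : Fin n), a₀ ∈ A → o ∉ A → (∀ a ∈ A, ∀ a' ∈ A, (Literature.Probability.LatticeModels.prodBernoulli w).real (Literature.Probability.Percolation.openConn a a')ᶜ ≤ δ) → (Literature.Probability.LatticeModels.prodBernoulli w).real (⋃ a ∈ A, Literature.Probability.Percolation.openConn o a)ᶜ ≤ δ → (Literature.Probability.LatticeModels.prodBernoulli w).real {ω : Literature.Probability.Percolation.BondConfig (Fin n) | ω ∉ Literature.Probability.Percolation.openConn o a₀ ∧ s₀ ≤ ((A.erase a₀).filter fun a => ω ∈ Literature.Probability.Percolation.openConn o a).card ∧ 2 * ((A.erase a₀).filter fun a => ω ∈ Literature.Probability.Percolation.openConn o a).card ≤ A.card ∧ d₀ < (A.filter fun a => ω ∈ Literature.Probability.Percolation.openConnIn ((↑A : Set (Fin n))ᶜ ∪ {o, a}) o a).card} ≤ ε := by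
  intro hG
  exact manyFingersLargePocket_of_nearOneGluing (nearOneGluing_of_gradedAG hG)

end Summit.CriticalPhenomena.PercolationContinuityZ3.Theorems
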